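import Mathlib
import Literature.Topology.PlaneTopology.WindingNumber
import Literature.Topology.PlaneTopology.ZerosPersist

/-!
# A generalised argument principle (stub `helper_generalisedArgumentPrinciple`, line Sketch)

Crux `stmt-SmoothPoincare4-7826` (`TameOrBrodyR4`), line `Sketch`, skeleton v17. Let `g : ℂ → ℂ`
be continuous on the closed disc `‖z‖ ≤ ρ` with finitely many zeros there, all of them in the
open disc and each admitting a neighbourhood on which `g` is holomorphic. If `g` has at least one
zero, then the winding number of `g` along the boundary circle
(`Literature.Topology.PlaneTopology.wind`, `circleLoop`) is non-zero — in fact it is at least the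
number of zeros (`GenArgPrinciple.ncard_le_wind`).

Proof (namespace `GenArgPrinciple`): induction on the number of zeros. With no zero, `g` has a
continuous logarithm on the (star-shaped) closed disc
(`Literature.Topology.PlaneTopology.hasLogOn_closedBall`), so the winding number vanishes
(`wind_comp_eq_zero_of_hasLogOn`). Otherwise pick a zero `z₀`; `g` is analytic at `z₀` and not
identically zero near `z₀` (its zero set in the disc is finite, whereas neighbourhoods are
infinite), so `g = (z - z₀)^m · h` near `z₀` with `m ≥ 1`, `h z₀ ≠ 0`
(`AnalyticAt.exists_eventuallyEq_pow_smul_nonzero_iff`). The function `g₁ := g / (z - z₀)^m`,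
extended by `h z₀` at `z₀`, is again continuous on the closed disc with the same local holomorphy
at its zeros, which are the zeros of `g` other than `z₀` (`divide_out`); and along the circle
`wind (g ∘ γ) = m · 1 + wind (g₁ ∘ γ)` (`wind_mul`, `wind_zpow`, `wind_circleLoop_sub_of_norm_lt`).
No complex integration is used.
-/

set_option linter.dupNamespace false

noncomputable section

open Filter Set Metric
open scoped Topology
open Literature.Topology.PlaneTopology

namespace Summit.SmoothPoincare4.SmoothPoincare4.Cruxes.TameOrBrodyR4.Sketch

namespace GenArgPrinciple

/-- No zeros: a continuous zero-free function on the closed disc `‖z‖ ≤ ρ` has winding number `0`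
along the boundary circle (it has a continuous logarithm on the disc). -/
theorem wind_eq_zero_of_forall_ne_zero {g : ℂ → ℂ} {ρ : ℝ} (hρ : 0 < ρ)
    (hg : ContinuousOn g (closedBall 0 ρ)) (hne : ∀ z ∈ closedBall (0 : ℂ) ρ, g z ≠ 0) :
    wind (fun t => g (circleLoop 0 ρ t)) = 0 :=
  wind_comp_eq_zero_of_hasLogOn (hasLogOn_closedBall hg hne)
    (continuous_circleLoop 0 ρ).continuousOn
    (fun t _ => sphere_subset_closedBall (circleLoop_mem_sphere 0 hρ.le t))
    (circleLoop_zero_eq 0 ρ)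

/-- Local structure at an isolated zero of an analytic germ: `g = (z - z₀)^m · h` near `z₀` with
`m ≥ 1`, `h` analytic at `z₀` and `h z₀ ≠ 0`. -/
theorem exists_pow_mul {g : ℂ → ℂ} {z₀ : ℂ} (hg : AnalyticAt ℂ g z₀) (h0 : g z₀ = 0)
    (hne : ¬ ∀ᶠ z in 𝓝 z₀, g z = 0) :
    ∃ (m : ℕ) (h : ℂ → ℂ), 1 ≤ m ∧ AnalyticAt ℂ h z₀ ∧ h z₀ ≠ 0 ∧
      ∀ᶠ z in 𝓝 z₀, g z = (z - z₀) ^ m * h z := by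
  obtain ⟨m, h, hh, hh0, hfac⟩ := hg.exists_eventuallyEq_pow_smul_nonzero_iff.mpr hne
  refine ⟨m, h, ?_, hh, hh0, by simpa only [smul_eq_mul] using hfac⟩
  rcases Nat.eq_zero_or_pos m with hm | hm
  · exfalso
    have h1 := hfac.self_of_nhds
    rw [h0, hm, pow_zero, one_smul] at h1
    exact hh0 h1.symm
  · exact hm

/-- The loop `t ↦ (γ t - z₀)^m` along the circle `γ` of radius `ρ > ‖z₀‖` about `0` does not vanish
and has winding number `m`. -/
theorem wind_pow_circleLoop_sub {z₀ : ℂ} {ρ : ℝ} (hz₀ : ‖z₀‖ < ρ) (m : ℕ) :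
    IsNonvanishingLoop (fun t => (circleLoop 0 ρ t - z₀) ^ m) ∧
      wind (fun t => (circleLoop 0 ρ t - z₀) ^ m) = m := by
  have hρ : 0 < ρ := (norm_nonneg _).trans_lt hz₀
  have hbase : IsNonvanishingLoop (fun t => circleLoop 0 ρ t - z₀) := by
    have h := isNonvanishingLoop_circleLoop (c := -z₀) (R := ρ) (by
      rw [norm_neg, abs_of_pos hρ]
      exact hz₀.ne)
    exact h.congr fun t _ => by rw [circleLoop_sub, zero_sub]
  have he : EqOn (fun t => (circleLoop 0 ρ t - z₀) ^ (m : ℤ))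
      (fun t => (circleLoop 0 ρ t - z₀) ^ m) (Icc 0 1) := fun t _ => zpow_natCast _ _
  refine ⟨(hbase.zpow m).congr he, ?_⟩
  rw [← wind_congr he, wind_zpow hbase, wind_circleLoop_sub_of_norm_lt (by simpa using hz₀),
    mul_one]

/-- **Dividing out one zero.** In the setting of the generalised argument principle, if
`g = (z - z₀)^m · h` near an interior point `z₀` (`h` analytic at `z₀`, `h z₀ ≠ 0`), then
`g₁ := g / (z - z₀)^m` (extended by `h z₀` at `z₀`) is continuous on the closed disc, its zeros
there are the zeros of `g` other than `z₀`, each again interior with a holomorphic neighbourhood,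
and `wind (g ∘ γ) = m + wind (g₁ ∘ γ)` along the boundary circle `γ`. -/
theorem divide_out {g : ℂ → ℂ} {ρ : ℝ} (hρ : 0 < ρ) (hg : ContinuousOn g (closedBall 0 ρ))
    (hin : ∀ z ∈ closedBall (0 : ℂ) ρ, g z = 0 → ‖z‖ < ρ ∧ ∃ s ∈ 𝓝 z, DifferentiableOn ℂ g s)
    {z₀ : ℂ} {m : ℕ} {h : ℂ → ℂ} (hz₀ : ‖z₀‖ < ρ) (hh : AnalyticAt ℂ h z₀) (hh0 : h z₀ ≠ 0)
    (hfac : ∀ᶠ z in 𝓝 z₀, g z = (z - z₀) ^ m * h z) :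
    ∃ g₁ : ℂ → ℂ, ContinuousOn g₁ (closedBall 0 ρ) ∧
      {z : ℂ | z ∈ closedBall (0 : ℂ) ρ ∧ g₁ z = 0} =
        {z : ℂ | z ∈ closedBall (0 : ℂ) ρ ∧ g z = 0} \ {z₀} ∧
      (∀ z ∈ closedBall (0 : ℂ) ρ, g₁ z = 0 → ‖z‖ < ρ ∧ ∃ s ∈ 𝓝 z, DifferentiableOn ℂ g₁ s) ∧
      wind (fun t => g (circleLoop 0 ρ t)) = m + wind (fun t => g₁ (circleLoop 0 ρ t)) := by
  classical
  -- the quotient off `z₀`, extended by `h z₀` at `z₀`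
  set g₁ : ℂ → ℂ := fun z => if z = z₀ then h z₀ else g z / (z - z₀) ^ m with hg₁_def
  have hpow : ∀ z, z ≠ z₀ → (z - z₀) ^ m ≠ 0 := fun z hz => pow_ne_zero _ (sub_ne_zero.mpr hz)
  have hg₁z₀ : g₁ z₀ = h z₀ := if_pos rfl
  have hg₁q : ∀ z, z ≠ z₀ → g₁ z = g z / (z - z₀) ^ m := fun z hz => if_neg hz
  have hmul : ∀ z, z ≠ z₀ → g z = (z - z₀) ^ m * g₁ z := fun z hz => by
    rw [hg₁q z hz, mul_div_cancel₀ _ (hpow z hz)]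
  have hzero : ∀ z, z ≠ z₀ → (g₁ z = 0 ↔ g z = 0) := fun z hz => by
    rw [hmul z hz, mul_eq_zero, or_iff_right (hpow z hz)]
  have hz₀ne : ∀ z, g₁ z = 0 → z ≠ z₀ := fun z hz0 hzz => by
    rw [hzz, hg₁z₀] at hz0
    exact hh0 hz0
  -- near `z₀`, `g₁ = h`
  have hnear : g₁ =ᶠ[𝓝 z₀] h := by
    filter_upwards [hfac] with z hz
    by_cases hzz : z = z₀
    · rw [hzz, hg₁z₀]
    · rw [hg₁q z hzz, hz, mul_div_cancel_left₀ _ (hpow z hzz)]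
  -- continuity on the closed disc
  have hcont : ContinuousOn g₁ (closedBall 0 ρ) := by
    intro z hz
    by_cases hzz : z = z₀
    · subst hzz
      exact (hh.continuousAt.congr_of_eventuallyEq hnear).continuousWithinAt
    · have hqc : ContinuousWithinAt (fun w => g w / (w - z₀) ^ m) (closedBall 0 ρ) z :=
        (hg z hz).div ((continuous_id.sub continuous_const).pow m).continuousWithinAt (hpow z hzz)
      refine hqc.congr_of_eventuallyEq ?_ (hg₁q z hzz)
      have hev : ∀ᶠ w in 𝓝 z, w ≠ z₀ := isOpen_ne.eventually_mem hzz
      filter_upwards [mem_nhdsWithin_of_mem_nhds hev] with w hw using hg₁q w hw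
  refine ⟨g₁, hcont, ?_, ?_, ?_⟩
  · -- the zero set
    ext z
    simp only [mem_setOf_eq, Set.mem_sdiff, mem_singleton_iff]
    constructor
    · rintro ⟨hz, hz0⟩
      exact ⟨⟨hz, (hzero z (hz₀ne z hz0)).mp hz0⟩, hz₀ne z hz0⟩
    · rintro ⟨⟨hz, hz0⟩, hzz⟩
      exact ⟨hz, (hzero z hzz).mpr hz0⟩
  · -- zeros of `g₁` are interior with a holomorphic neighbourhood
    intro z hz hz0
    have hzz : z ≠ z₀ := hz₀ne z hz0
    obtain ⟨hlt, s, hs, hd⟩ := hin z hz ((hzero z hzz).mp hz0)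
    refine ⟨hlt, s ∩ {w | w ≠ z₀}, inter_mem hs (isOpen_ne.mem_nhds hzz), ?_⟩
    have hqd : DifferentiableOn ℂ (fun w => g w / (w - z₀) ^ m) (s ∩ {w | w ≠ z₀}) :=
      (hd.mono inter_subset_left).div
        ((differentiableOn_id.sub (differentiableOn_const _)).pow m) fun w hw => hpow w hw.2
    exact hqd.congr fun w hw => hg₁q w hw.2
  · -- the winding numbers
    have hγ : ∀ t, circleLoop 0 ρ t ∈ closedBall (0 : ℂ) ρ := fun t =>
      sphere_subset_closedBall (circleLoop_mem_sphere 0 hρ.le t)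
    have hγn : ∀ t, ‖circleLoop 0 ρ t‖ = ρ := fun t => by
      simpa using circleLoop_mem_sphere 0 hρ.le t
    have hγne : ∀ t, circleLoop 0 ρ t ≠ z₀ := fun t heq => by
      have h1 := hγn t
      rw [heq] at h1
      exact hz₀.ne h1
    have hgne : ∀ t, g (circleLoop 0 ρ t) ≠ 0 := fun t h0 => by
      have h1 := (hin _ (hγ t) h0).1
      rw [hγn t] at h1
      exact lt_irrefl _ h1
    obtain ⟨hl1, hw1⟩ := wind_pow_circleLoop_sub hz₀ m
    have hl2 : IsNonvanishingLoop (fun t => g₁ (circleLoop 0 ρ t)) := by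
      refine ⟨hcont.comp (continuous_circleLoop 0 ρ).continuousOn fun t _ => hγ t,
        fun t _ h0 => hgne t ?_, by rw [circleLoop_zero_eq]⟩
      rw [hmul _ (hγne t), h0, mul_zero]
    rw [wind_congr (g := fun t => (circleLoop 0 ρ t - z₀) ^ m * g₁ (circleLoop 0 ρ t))
      (fun t _ => hmul _ (hγne t)), wind_mul hl1 hl2, hw1]

/-- **The count.** Under the hypotheses of the generalised argument principle (without the
existence of a zero), the winding number along the boundary circle is at least the number of zeros
in the closed disc. -/
theorem ncard_le_wind {ρ : ℝ} (hρ : 0 < ρ) (n : ℕ) :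
    ∀ g : ℂ → ℂ, ContinuousOn g (closedBall 0 ρ) →
      {z : ℂ | z ∈ closedBall (0 : ℂ) ρ ∧ g z = 0}.Finite →
      {z : ℂ | z ∈ closedBall (0 : ℂ) ρ ∧ g z = 0}.ncard = n →
      (∀ z ∈ closedBall (0 : ℂ) ρ, g z = 0 → ‖z‖ < ρ ∧ ∃ s ∈ 𝓝 z, DifferentiableOn ℂ g s) →
      (n : ℤ) ≤ wind (fun t => g (circleLoop 0 ρ t)) := by
  induction n with
  | zero =>
    intro g hg hfin hcard hin
    have hempty : {z : ℂ | z ∈ closedBall (0 : ℂ) ρ ∧ g z = 0} = ∅ := (ncard_eq_zero hfin).mp hcard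
    have hne : ∀ z ∈ closedBall (0 : ℂ) ρ, g z ≠ 0 := fun z hz h0 => by
      have hmem : z ∈ {z : ℂ | z ∈ closedBall (0 : ℂ) ρ ∧ g z = 0} := ⟨hz, h0⟩
      rw [hempty] at hmem
      exact hmem
    rw [Nat.cast_zero, wind_eq_zero_of_forall_ne_zero hρ hg hne]
  | succ n ih =>
    intro g hg hfin hcard hin
    -- pick a zero `z₀`
    obtain ⟨z₀, hz₀, hgz₀⟩ : {z : ℂ | z ∈ closedBall (0 : ℂ) ρ ∧ g z = 0}.Nonempty :=
      nonempty_of_ncard_ne_zero (by rw [hcard]; exact Nat.succ_ne_zero n)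
    obtain ⟨hlt, s, hs, hd⟩ := hin z₀ hz₀ hgz₀
    have han : AnalyticAt ℂ g z₀ := hd.analyticAt hs
    -- `g` is not identically zero near `z₀`: its zero set in the disc is finite
    have hnotev : ¬ ∀ᶠ z in 𝓝 z₀, g z = 0 := fun hev => by
      have hmem : {z : ℂ | z ∈ closedBall (0 : ℂ) ρ ∧ g z = 0} ∈ 𝓝 z₀ := by
        have hball : closedBall (0 : ℂ) ρ ∈ 𝓝 z₀ :=
          closedBall_mem_nhds_of_mem (mem_ball_zero_iff.mpr hlt)
        filter_upwards [hball, hev] with z hz hz0 using ⟨hz, hz0⟩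
      exact infinite_of_mem_nhds z₀ hmem hfin
    obtain ⟨m, h, hm, hh, hh0, hfac⟩ := exists_pow_mul han hgz₀ hnotev
    obtain ⟨g₁, hg₁, hZ, hin₁, hw⟩ := divide_out hρ hg hin hlt hh hh0 hfac
    have hfin₁ : {z : ℂ | z ∈ closedBall (0 : ℂ) ρ ∧ g₁ z = 0}.Finite := by
      rw [hZ]
      exact hfin.sdiff
    have hcard₁ : {z : ℂ | z ∈ closedBall (0 : ℂ) ρ ∧ g₁ z = 0}.ncard = n := by
      have hmem : z₀ ∈ {z : ℂ | z ∈ closedBall (0 : ℂ) ρ ∧ g z = 0} := ⟨hz₀, hgz₀⟩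
      rw [hZ, ncard_sdiff_singleton_of_mem hmem, hcard, Nat.add_sub_cancel]
    have key := ih g₁ hg₁ hfin₁ hcard₁ hin₁
    rw [hw]
    push_cast
    omega

end GenArgPrinciple

/-- (GAP) generalised argument principle: a continuous function on a closed disc with finitely
many zeros, all interior and each with a holomorphic neighbourhood, and at least one zero, has
non-zero winding number along the boundary circle. -/
theorem helper_generalisedArgumentPrinciple (g : ℂ → ℂ) (ρ : ℝ) (hρ : 0 < ρ)
    (hg : ContinuousOn g (closedBall 0 ρ))
    (hfin : {z : ℂ | z ∈ closedBall (0 : ℂ) ρ ∧ g z = 0}.Finite)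
    (hin : ∀ z ∈ closedBall (0 : ℂ) ρ, g z = 0 → ‖z‖ < ρ ∧ ∃ s ∈ 𝓝 z, DifferentiableOn ℂ g s)
    (hex : ∃ z ∈ closedBall (0 : ℂ) ρ, g z = 0) :
    Literature.Topology.PlaneTopology.wind
      (fun t => g (Literature.Topology.PlaneTopology.circleLoop 0 ρ t)) ≠ 0 := by
  obtain ⟨z₀, hz₀, h0⟩ := hex
  have hpos : 0 < {z : ℂ | z ∈ closedBall (0 : ℂ) ρ ∧ g z = 0}.ncard :=
    (ncard_pos hfin).mpr ⟨z₀, hz₀, h0⟩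
  have key := GenArgPrinciple.ncard_le_wind hρ _ g hg hfin rfl hin
  omega

end Summit.SmoothPoincare4.SmoothPoincare4.Cruxes.TameOrBrodyR4.Sketch
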